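import Mathlib
import HarnessLib
import Summits.NavierStokesRegularity.NavierStokesRegularity.Theorems.UnthreadedDoorAntidynamoWallKillingFrame

/-!
# Route `UnthreadedDoor` / `ThreadingFlux`, crux `PoloidalLiouville` (stmt-NavierStokesRegularity-1222), antidynamo v2 skeleton (sha16 `4ebf5683127b`),
# WALL `stub_scalarLiouville`: GENERALIZED BELTRAMI MODULO A RIGID-MOTION (KILLING) FIELD ⇒ IRROTATIONAL

Support file (seat leafhand-ns-unthreadeddoor-2 g4, cell decomp-ns), `--supports stmt-NavierStokesRegularity-1222 --as helper`; theorems only.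
Part 2 of 2 of the Killing-frame sector (part 1: `…WallKillingFrame`, the co-moving heat Liouville).

If the Lamb vector of `v − ξ`, `ξ(y) = b + Ω × y` a Killing field (translations `Ω = 0` are the Galilean sector (C5)/(C9)/(C5'') of the core), is
curl-free — `curl ((v(t) − ξ) × curl v(t)) ≡ 0` — then the vorticity equation is the Killing-caloric law `∂ₜω = Δω + Jω − Dω[ξ]` (§3, Lamb identity
`curl ((v − ξ) × ω) = (Dv − J)ω − Dω[v − ξ]`, `div ξ = tr J = 0`, `div ω = 0`), and part 1 closes the flow:

* §3 `timeDerivWithin_vorticity_eq_of_lamb_killing`;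
* §4 ★★ `curl_eq_zero_of_lamb_killing_farPast` — curl-free on a far past `(−∞, t₁)`, `t₁ ≤ 0` ⇒ `curl v ≡ 0` on `(−∞,0) × ℝ³`;
  ★★ `curl_eq_zero_of_lamb_killing_frequently` — curl-free for ONE FIXED Killing field at times accumulating at some `t₀ < 0` ⇒ `curl v ≡ 0`
  (identity theorem in the analytic frame of `CellFlux.unthreadedAnalyticOrIrrotational`); `constant_of_lamb_killing_frequently`; and the wall's letter
  `stubScalarLiouville_of_lamb_killing_frequently` (free hypothesis (C10): «for no Killing field `ξ` and no `t₀ < 0` is the Lamb vector of `v − ξ`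
  curl-free at times accumulating at `t₀`» — rigidly ROTATING / SCREW-MOVING vorticity patterns that are Lie-transported up to diffusion are trivial).

HONEST LABEL: a sector closer; the generic core of the wall (= (ML-a)) is OPEN; nothing here proves `stub_scalarLiouville`, `PoloidalLiouville` (1222), or
bears on Navier–Stokes regularity; no summit statement is proved.
[folklore] [cite: MajdaBertozziCUP2002, §1.1 (vector identities); KochNadirashviliSereginSverak2009, Thm 5.2 (arXiv:0709.3599 pp. 9–10); LemarieRieusset2016, Thm. 9.12]
-/

noncomputable section

-- the summit and its single sub-problem share the name (CONVENTIONS §1)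
set_option linter.dupNamespace false

open scoped Topology InnerProductSpace RealInnerProductSpace ContDiff Laplacian
open Filter Set Function MeasureTheory
open Literature.Analysis Literature.Analysis.FluidPDE

namespace Summit.NavierStokesRegularity.NavierStokesRegularity.Theorems.PoloidalLiouville.Antidynamo

open Summit.NavierStokesRegularity.NavierStokesRegularity.Theorems.PoloidalLiouville
  (toroidalPotential exists_norm_curl_le constantOfIrrotational vorticityOfClass)
open Summit.NavierStokesRegularity.NavierStokesRegularity.Theorems.PoloidalLiouville.NetFlux (E3)

namespace Killing

/-! ### §3 The Lamb hypothesis gives the Killing-caloric law -/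

/-- **THE VORTICITY OF A FLOW WHOSE LAMB VECTOR IS CURL-FREE IN A KILLING FRAME IS KILLING-CALORIC.**  For a classical solution of the vorticity
formulation on `(−∞,0)` with `curl ((v(t) − ξ) × curl v(t)) ≡ 0` on `(−∞, t₁)`, `ξ(y) = b + Ω × y`: `∂ₜω = Δω + Jω − Dω[ξ]` there (`J = Ω × ·`;
`curl ((v − ξ) × ω) = (Dv − J)ω − Dω[v − ξ]` by the Lamb identity, `div ξ = 0`, `div ω = 0`). [cite: MajdaBertozziCUP2002, §1.1 (vector identities)] -/
theorem timeDerivWithin_vorticity_eq_of_lamb_killing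
    {v : ℝ → EuclideanSpace ℝ (Fin 3) → EuclideanSpace ℝ (Fin 3)} (hV : IsVorticitySolutionOn (Iio 0) 1 v)
    (b Ω : EuclideanSpace ℝ (Fin 3)) {t₁ : ℝ} (ht₁ : t₁ ≤ 0)
    (hlamb : ∀ t < t₁, ∀ x, curl (fun y => cross (v t y - (b + crossCLM Ω y)) (curl (v t) y)) x = 0) {t : ℝ} (ht : t < t₁)
    (x : EuclideanSpace ℝ (Fin 3)) :
    timeDerivWithin (Iio 0) (vorticity v) t x =
      (Δ (vorticity v t)) x + crossCLM Ω (vorticity v t x) - fderiv ℝ (vorticity v t) x (b + crossCLM Ω x) := by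
  have ht0 : t < 0 := lt_of_lt_of_le ht ht₁
  have E := hV.vorticity_eq t ht0 x
  have hvs : ContDiff ℝ ∞ (v t) := hV.contDiff_velocity ht0
  have hv2 : ContDiff ℝ 2 (v t) := hvs.of_le (by norm_cast)
  have hω1 : ContDiff ℝ 1 (curl (v t)) := contDiff_curl (n := 1) hv2
  have hvd : DifferentiableAt ℝ (v t) x := (hv2.differentiable (by norm_num)) x
  have hξ : HasFDerivAt (fun y : EuclideanSpace ℝ (Fin 3) => b + crossCLM Ω y) (crossCLM Ω) x := hasFDerivAt_killing b Ω x
  have hwd : DifferentiableAt ℝ (fun y => v t y - (b + crossCLM Ω y)) x := hvd.sub hξ.differentiableAt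
  have hωd : DifferentiableAt ℝ (curl (v t)) x := (hω1.differentiable one_ne_zero) x
  have hDw : fderiv ℝ (fun y => v t y - (b + crossCLM Ω y)) x = fderiv ℝ (v t) x - crossCLM Ω :=
    (hvd.hasFDerivAt.sub hξ).fderiv
  have hdivw : VectorCalculus.divergence (fun y => v t y - (b + crossCLM Ω y)) x = 0 := by
    have h1 : VectorCalculus.divergence (v t) x = 0 := hV.divFree t ht0 x
    have h2 := divergence_killing b Ω x
    unfold VectorCalculus.divergence at h1 h2 ⊢
    rw [hξ.fderiv] at h2
    rw [hDw, ContinuousLinearMap.toLinearMap_sub, map_sub, h1, h2, sub_zero]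
  have hdivω : VectorCalculus.divergence (curl (v t)) x = 0 := divergence_curl_eq_zero_holds (v t) hv2 x
  have hL := hlamb t ht x
  rw [curl_cross_apply hwd hωd, hdivw, hdivω, zero_smul, zero_smul, sub_zero, add_zero, hDw, map_sub] at hL
  -- `hL : (Dv − J)[ω] − (Dω[v] − Dω[ξ]) = 0`
  rw [one_smul] at E
  have hωfun : vorticity v t = curl (v t) := funext fun y => by rw [vorticity_apply]
  simp only [convect, hωfun] at E
  -- `E : T + Dω[v x] = Dv[ω x] + Δω`
  rw [hωfun]
  have h3 : timeDerivWithin (Iio 0) (vorticity v) t x =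
      fderiv ℝ (v t) x (curl (v t) x) + (Δ (curl (v t))) x - fderiv ℝ (curl (v t)) x (v t x) := by
    rw [← E]; abel
  have hA : fderiv ℝ (v t) x (curl (v t) x) =
      fderiv ℝ (curl (v t)) x (v t x) - fderiv ℝ (curl (v t)) x (b + crossCLM Ω x) + crossCLM Ω (curl (v t) x) := by
    have h := sub_eq_zero.1 hL
    rw [sub_apply] at h
    rw [← h]
    abel
  rw [h3, hA]
  abel

/-! ### ★★ §4 The closers -/

/-- ★★ **GENERALIZED BELTRAMI MODULO A KILLING FIELD ON A FAR PAST ⇒ IRROTATIONAL.**  Let `v` be a bounded ancient mild solution (`ν = 1`, duality class)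
with measurable slices, jointly smooth on `(−∞,0) × ℝ³`, whose vorticity is tangent to the spheres about `x₀`.  If for a Killing field `ξ(y) = b + Ω × y`
(an infinitesimal screw motion: translation `b`, rotation rate `Ω`, any axis) the Lamb vector of `v − ξ` is curl-free at every time of a far past
`(−∞, t₁)`, `t₁ ≤ 0`, then `curl v ≡ 0` on `(−∞,0) × ℝ³` (Killing-caloric law §3, co-moving heat Liouville §2, one-instant closer p816256).
[cite: KochNadirashviliSereginSverak2009, Thm 5.2 (arXiv:0709.3599 pp. 9–10)] -/
theorem curl_eq_zero_of_lamb_killing_farPast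
    (v : ℝ → EuclideanSpace ℝ (Fin 3) → EuclideanSpace ℝ (Fin 3)) (x₀ : EuclideanSpace ℝ (Fin 3))
    (hB : Literature.Analysis.FluidPDE.IsBoundedAncientMildSolution 1 v)
    (hm : ∀ t < 0, AEStronglyMeasurable (v t) volume)
    (hsm : ContDiffOn ℝ (⊤ : ℕ∞) (Function.uncurry v) (Set.Iio 0 ×ˢ Set.univ))
    (hun : ∀ t < 0, ∀ x, ⟪x - x₀, curl (v t) x⟫ = 0)
    (b Ω : EuclideanSpace ℝ (Fin 3)) {t₁ : ℝ} (ht₁ : t₁ ≤ 0)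
    (hlamb : ∀ t < t₁, ∀ x, curl (fun y => cross (v t y - (b + crossCLM Ω y)) (curl (v t) y)) x = 0) :
    ∀ t < 0, ∀ x, curl (v t) x = 0 := by
  obtain ⟨hV, K, hK⟩ := vorticityOfClass v hB hm hsm
  have hfar : ∀ t < t₁, ∀ x, curl (v t) x = 0 :=
    curl_eq_zero_of_killingCaloric_unthreaded hV hK x₀ hun b Ω ht₁ fun t ht x =>
      timeDerivWithin_vorticity_eq_of_lamb_killing hV b Ω ht₁ hlamb ht x
  exact curl_eq_zero_of_curl_slice_eq_zero v x₀ hB hm hsm hun ⟨t₁ - 1, by linarith, hfar (t₁ - 1) (by linarith)⟩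

/-- **Joint analyticity of the Lamb field in a Killing frame.** [folklore] -/
theorem analyticOnNhd_lamb_killing_uncurry {V : ℝ → E3 → E3} (b Ω : E3)
    (hV : AnalyticOnNhd ℝ (uncurry V) (Iio (0 : ℝ) ×ˢ (univ : Set E3))) :
    AnalyticOnNhd ℝ (uncurry fun t y => cross (V t y - (b + crossCLM Ω y)) (curl (V t) y)) (Iio (0 : ℝ) ×ˢ (univ : Set E3)) := by
  have hω := CellFlux.analyticOnNhd_curl_uncurry hV
  have hξ : AnalyticOnNhd ℝ (fun p : ℝ × E3 => b + crossCLM Ω p.2) (Iio (0 : ℝ) ×ˢ (univ : Set E3)) :=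
    fun p _ => analyticAt_const.add (((crossCLM Ω).analyticAt p.2).comp analyticAt_snd)
  have h1 : AnalyticOnNhd ℝ (fun p : ℝ × E3 => uncurry V p - (b + crossCLM Ω p.2)) (Iio (0 : ℝ) ×ˢ (univ : Set E3)) := hV.sub hξ
  have hbil := crossCLM.analyticOnNhd_bilinear (univ : Set (E3 × E3))
  have h2 := hbil.comp (h1.prod hω) (mapsTo_univ _ _)
  refine h2.congr (isOpen_Iio.prod isOpen_univ) ?_
  rintro ⟨t, y⟩ -
  rfl

/-- **Hence `t ↦ curl((V(t) − ξ) × curl V(t))(x)` is real-analytic on `(−∞,0)` for every `x`.** [folklore] -/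
theorem analyticOnNhd_curl_lamb_killing_slice {V : ℝ → E3 → E3} (b Ω : E3)
    (hV : AnalyticOnNhd ℝ (uncurry V) (Iio (0 : ℝ) ×ˢ (univ : Set E3))) (x : E3) :
    AnalyticOnNhd ℝ (fun t => curl (fun y => cross (V t y - (b + crossCLM Ω y)) (curl (V t) y)) x) (Iio 0) := by
  have hL := CellFlux.analyticOnNhd_curl_uncurry (V := fun t y => cross (V t y - (b + crossCLM Ω y)) (curl (V t) y))
    (analyticOnNhd_lamb_killing_uncurry b Ω hV)
  intro t ht
  exact (hL (t, x) ⟨ht, mem_univ _⟩).comp₂ analyticAt_id analyticAt_const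

/-- ★★ **GENERALIZED BELTRAMI MODULO A FIXED KILLING FIELD AT ACCUMULATING TIMES ⇒ IRROTATIONAL.**  If for ONE Killing field `ξ = b + Ω × ·` the Lamb
vector of `v − ξ` is curl-free at a set of times accumulating at some `t₀ < 0`, then `curl v ≡ 0` (identity theorem in the analytic frame of
`CellFlux.unthreadedAnalyticOrIrrotational`, then the far-past closer). [cite: KochNadirashviliSereginSverak2009, Thm 5.2 (arXiv:0709.3599 pp. 9–10)] -/
theorem curl_eq_zero_of_lamb_killing_frequently
    (v : ℝ → EuclideanSpace ℝ (Fin 3) → EuclideanSpace ℝ (Fin 3)) (x₀ : EuclideanSpace ℝ (Fin 3))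
    (hB : Literature.Analysis.FluidPDE.IsBoundedAncientMildSolution 1 v)
    (hm : ∀ t < 0, AEStronglyMeasurable (v t) volume)
    (hsm : ContDiffOn ℝ (⊤ : ℕ∞) (Function.uncurry v) (Set.Iio 0 ×ˢ Set.univ))
    (hun : ∀ t < 0, ∀ x, ⟪x - x₀, curl (v t) x⟫ = 0)
    (b Ω : EuclideanSpace ℝ (Fin 3))
    (hfr : ∃ t₀ < 0, ∃ᶠ t in 𝓝[≠] t₀, ∀ x, curl (fun y => cross (v t y - (b + crossCLM Ω y)) (curl (v t) y)) x = 0) :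
    ∀ t < 0, ∀ x, curl (v t) x = 0 := by
  obtain ⟨t₀, ht₀, hfr⟩ := hfr
  obtain ⟨K, hK⟩ := exists_norm_curl_le hB hsm
  obtain ⟨T, -, -, hlink⟩ := toroidalPotential v x₀ K hsm hK hun
  rcases CellFlux.unthreadedAnalyticOrIrrotational v x₀ T hB hm hsm hlink with hA | hZ
  swap
  · exact hZ
  have hall : ∀ t < 0, ∀ x, curl (fun y => cross (v t y - (b + crossCLM Ω y)) (curl (v t) y)) x = 0 := by
    intro t ht x
    have hga := analyticOnNhd_curl_lamb_killing_slice b Ω hA x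
    have hgfr : ∃ᶠ s in 𝓝[≠] t₀, (fun s => curl (fun y => cross (v s y - (b + crossCLM Ω y)) (curl (v s) y)) x) s = 0 :=
      hfr.mono fun s hs => hs x
    have h0 := hga.eqOn_zero_of_preconnected_of_frequently_eq_zero isPreconnected_Iio ht₀ hgfr ht
    simpa only [Pi.zero_apply] using h0
  exact curl_eq_zero_of_lamb_killing_farPast v x₀ hB hm hsm hun b Ω le_rfl fun t ht x => hall t ht x

/-- ★★ **… HENCE SLICE-WISE CONSTANT.** [cite: KochNadirashviliSereginSverak2009, Thm 5.2 (arXiv:0709.3599 pp. 9–10)] -/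
theorem constant_of_lamb_killing_frequently
    (v : ℝ → EuclideanSpace ℝ (Fin 3) → EuclideanSpace ℝ (Fin 3)) (x₀ : EuclideanSpace ℝ (Fin 3))
    (hB : Literature.Analysis.FluidPDE.IsBoundedAncientMildSolution 1 v)
    (hm : ∀ t < 0, AEStronglyMeasurable (v t) volume)
    (hsm : ContDiffOn ℝ (⊤ : ℕ∞) (Function.uncurry v) (Set.Iio 0 ×ˢ Set.univ))
    (hun : ∀ t < 0, ∀ x, ⟪x - x₀, curl (v t) x⟫ = 0)
    (b Ω : EuclideanSpace ℝ (Fin 3))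
    (hfr : ∃ t₀ < 0, ∃ᶠ t in 𝓝[≠] t₀, ∀ x, curl (fun y => cross (v t y - (b + crossCLM Ω y)) (curl (v t) y)) x = 0) :
    ∀ t < 0, ∃ c : EuclideanSpace ℝ (Fin 3), ∀ x, v t x = c :=
  constantOfIrrotational v hB hsm (curl_eq_zero_of_lamb_killing_frequently v x₀ hB hm hsm hun b Ω hfr)

/-- **THE WALL ON THE KILLING-FRAME SECTOR.**  `StubScalarLiouville` holds as soon as its conclusion is known for the flows of its class whose Lamb vector is,
for NO Killing field `b + Ω × ·` and NO `t₀ < 0`, curl-free at times accumulating at `t₀` (hypothesis `hrest`); the complementary sector is closed by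
`curl_eq_zero_of_lamb_killing_frequently`.  (`Ω = 0` is the Galilean sector (C9) of core v6.) [cite: KochNadirashviliSereginSverak2009, Thm 5.2 (arXiv:0709.3599 pp. 9–10)] -/
theorem stubScalarLiouville_of_lamb_killing_frequently
    (hrest : ∀ (v : ℝ → EuclideanSpace ℝ (Fin 3) → EuclideanSpace ℝ (Fin 3)) (x₀ : EuclideanSpace ℝ (Fin 3))
      (T : ℝ → EuclideanSpace ℝ (Fin 3) → ℝ),
      Literature.Analysis.FluidPDE.IsBoundedAncientMildSolution 1 v →
      (∀ t < 0, AEStronglyMeasurable (v t) volume) →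
      ContDiffOn ℝ (⊤ : ℕ∞) (Function.uncurry v) (Set.Iio 0 ×ˢ Set.univ) →
      ContDiffOn ℝ (⊤ : ℕ∞) (Function.uncurry T) (Set.Iio 0 ×ˢ ({x₀}ᶜ : Set (EuclideanSpace ℝ (Fin 3)))) →
      (∃ C : ℝ, ∀ t < 0, ∀ x, |T t x| ≤ C) →
      (∀ t < 0, ∀ x, Literature.Analysis.FluidPDE.curl (v t) x =
        Literature.Analysis.FluidPDE.cross (gradient (T t) x) (x - x₀)) →
      (∀ t < 0, ∀ x, x ≠ x₀ →
        Literature.Analysis.FluidPDE.cross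
            (gradient (fun z => deriv (fun s => T s z) t + inner ℝ (v t z) (gradient (T t) z)
              - Laplacian.laplacian (T t) z) x) (x - x₀) =
          Literature.Analysis.FluidPDE.cross (gradient (fun z => inner ℝ (v t z) (z - x₀)) x) (gradient (T t) x)) →
      (∀ (b Ω : EuclideanSpace ℝ (Fin 3)) (t₀ : ℝ), t₀ < 0 →
        ¬ ∃ᶠ t in 𝓝[≠] t₀, ∀ x, curl (fun y => cross (v t y - (b + crossCLM Ω y)) (curl (v t) y)) x = 0) →
      ∀ t < 0, ∀ x, Literature.Analysis.FluidPDE.cross (gradient (T t) x) (x - x₀) = 0) :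
    StubScalarLiouville := by
  intro v x₀ T hB hm hsm hT hTb hrep hE
  have hun : ∀ s < 0, ∀ z, ⟪z - x₀, curl (v s) z⟫ = 0 := fun s hs z => by
    rw [hrep s hs z]
    simp [cross, crossProduct, PiLp.inner_apply, Fin.sum_univ_three]
    ring
  by_cases hsec : ∃ (b Ω : EuclideanSpace ℝ (Fin 3)) (t₀ : ℝ), t₀ < 0 ∧
      ∃ᶠ t in 𝓝[≠] t₀, ∀ x, curl (fun y => cross (v t y - (b + crossCLM Ω y)) (curl (v t) y)) x = 0
  · obtain ⟨b, Ω, t₀, ht₀, hfr⟩ := hsec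
    intro t ht x
    rw [← hrep t ht x]
    exact curl_eq_zero_of_lamb_killing_frequently v x₀ hB hm hsm hun b Ω ⟨t₀, ht₀, hfr⟩ t ht x
  · exact hrest v x₀ T hB hm hsm hT hTb hrep hE (fun b Ω t₀ ht₀ h => hsec ⟨b, Ω, t₀, ht₀, h⟩)

end Killing

end Summit.NavierStokesRegularity.NavierStokesRegularity.Theorems.PoloidalLiouville.Antidynamo

end
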